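import Summits.BirchSwinnertonDyer.BirchSwinnertonDyer.Theorems.PrintCf2SplitBadTwoRestrictedSelmerBaseLiftOfLocSurj
import Summits.BirchSwinnertonDyer.BirchSwinnertonDyer.Theorems.PrintCf2SplitBadTwoRestrictedSelmerCMSideConditions
import Summits.BirchSwinnertonDyer.Rank1Residual.X11b.LocalPrimaryCohomologyEP
import Summits.BirchSwinnertonDyer.Rank1Residual.X11b.LocSurjFromLevels
import HarnessLib

/-!
# Crux `PrintCf2.SplitBadTwoRankOneOfFacts` (stmt-BirchSwinnertonDyer-20368), road α v10.3, S3c residual (LS) — leaf file 2: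
# THE KILLING EXPONENT OF THE RELAXED CONJUGATE GROUP OF THE CONJUGATE SUMMAND, from the level-`K` finiteness `hfinB′` alone

Cell `bsd-print-cf2`, EXTRA WIDTH seat `bsd-line-cf2-p1-w3` g9 (prover-bsd-line-cf2-p1-w3-g9-0); `--supports stmt-BirchSwinnertonDyer-20368`
(helper, Theses-free). HONEST FRAMING: nothing here closes the crux or a registered stub; BSD is not proved by any of this; no summit statement
is proved by this seat. No definition, no named fact, no `sorry`, no kit. beyond-print theorem: no. UNCONDITIONAL (Milne I 2.8 at the
completions is the tree theorem `localEulerPoincareCharacteristic_adicCompletionEP`).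

WHY (-w4 g9 `TURNKEY-20368-LS-w4g9.md` §2 (b); LEAD g12 ruling 2026-08-28T21:04:53Z). X11b's finite-level Poitou–Tate argument
(`AcSelmer.sum_localTatePairingZMod_liftFamily_eq_zero(_anyTorsion)`, JSW17 Prop. 3.3.2) needs ONE exponent `p^e` killing Castella's relaxed
conjugate group `H¹_{𝓛^{ac,R}_𝔮}(K, E[p^∞])` (strict at `𝔮`, relaxed at the other prime above `p` and on the finite set `R` away from `p`). For
the CM summand `W* = E[𝔮_r^∞]` of road α that group is INFINITE (its `W*`-part contains the Kummer image of `E(K) ⊗ ℚ_p/ℤ_p`); the port to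
`W*`-valued families (-w4 g9) kills the `W*`-part by isotropy (`LevelEigen.cupProduct_map_levelProj_eq_zero`, p669287) and needs the exponent
ONLY on the conjugate summand `W*′ = E[𝔮_{r′}^∞]`. THIS FILE supplies it from the finiteness of Agboola's level-`K` restricted group of the
conjugate summand, `hfinB′ : Finite 𝔖_𝔮(K, W*′)` (the bottom finiteness of the CONJUGATE S3c frame), and nothing else.

WHAT IS PROVED (generic: number field `K`, elliptic `V/K`, prime `p`, ANY finite place `𝔮` as the strict place, ANY `K`-rational `π`, `p`-adic
`r′`, ANY additive equivariant projector `e′ : E[p^∞] → W*′ = endEigenPrimaryTorsion p π r′` with `e′ ∘ ι′ = id` — -w7 g2's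
`exists_eigenProjector` currency — and ANY finite `R` away from `p`).
* §1 (generic discrete Galois modules `ρ → ρ′`): `map_mem_selmerGroup_acStructure` — an intertwining map carries `H¹_{𝓛^{ac,R}_𝔮}(K, M)` into
  `H¹_{𝓛^{ac,R}_𝔮}(K, M′)` (Castella's conditions are «zero» / «everything», preserved by `H¹(f)` via `localization_map_one`);
  `galoisCohomology_map_restrictField_injective` (`H¹(f|_E)` injective when `g ∘ f = id`, X11b `map_injective_of_comp_eq` over a `K`-field);
  `finite_galoisCohomology_toLocal_of_retraction` (a retraction makes `H¹(K_v, M) ↪ H¹(K_v, M′)`, so finiteness descends).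
* §2 (the summand as a discrete Galois module `LocBridge.ofSMul W*′`): `exists_summandIncl` (`ι′` as an intertwining map), `exists_summandProj`
  (`e′` as an intertwining map `E[p^∞] → W*′`), `finite_galoisCohomology_summand_toLocal` (`H¹(K_v, W*′)` finite at every finite `v ∤ p`,
  from X11b `finite_galoisCohomology_one_primary_toLocalEP` through `ι′`), `finite_selmerGroup_acStructure_summand_empty_of_finite_restrictedSelmerBase`
  (`hfinB′` transported to the Selmer-structure side by X11b `natCard_selmerOver_top_eq`), `finite_selmerGroup_acStructure_summand`
  (relaxed on `R`: X11b `finite_selmerGroup_acStructure_of_finite_empty`).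
* §3 THE EXPONENT: `exists_pow_nsmul_map_summandProj_eq_zero` — `∃ e ≥ 1, ∀ x ∈ H¹_{𝓛^{ac,R}_𝔮}(K, E[p^∞]), p^e · H¹(e′) x = 0`; and the
  endomorphism form the obstruction lemma consumes, `exists_pow_nsmul_map_eq_zero_of_apply_eq_proj` — for EVERY intertwining endomorphism
  `ψ′` of `E[p^∞]` with `ψ′ Q = ι′(e′ Q)`: `p^e · H¹(ψ′) x = 0` on the same group (so X11b's hypothesis `he` holds for the `W*′`-COMPONENT).

presearch: JSW17 Prop. 3.3.2 (arXiv:1512.06894 p. 11: «torsion-free … injects into the finite H¹_{(𝓕_ac^S)_v̄}(K, W)»); Greenberg LNM 1716 §3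
Lemma 3.3 (p. 87); Milne ADT I 2.8 — all held; no new fact (tree theorems only).

References: [JetchevSkinnerWan2017] Prop. 3.3.2; [GreenbergLNM1716] §3 Lemma 3.3; [MilneADT2006] I Thm. 2.8, I §6; [Castella2018] Def. 2.2;
[Agboola2007] §3 (the restricted Selmer groups `𝔖_𝔮(K, W*)`).
-/

noncomputable section

open scoped Classical

set_option linter.dupNamespace false
set_option autoImplicit false

open CategoryTheory NumberField IsDedekindDomain Field WeierstrassCurve
open Literature.NumberTheory.EllipticCurves Literature.NumberTheory.EllipticCurves.GreenbergSelmer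
open Literature.NumberTheory.EllipticCurves.Agboola2007
open Literature.NumberTheory.GaloisRepresentations
open Literature.NumberTheory.GaloisRepresentations.DiscreteGaloisModule (SelmerStructure)
open scoped ContRepresentation

universe u

namespace Summit.BirchSwinnertonDyer.BirchSwinnertonDyer.Theorems.PrintCf2.RelaxedExponent

open Summit.BirchSwinnertonDyer.Rank1Residual.X11b
open Summit.BirchSwinnertonDyer.Rank1Residual.X11b.AcSelmer
open Summit.BirchSwinnertonDyer.Rank1Residual.X11b.LocBridge
open Summit.BirchSwinnertonDyer.Rank1Residual.X11b.Levels
open Summit.BirchSwinnertonDyer.BirchSwinnertonDyer.Theorems.PrintCf2.RestrictedSelmerPair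

/-! ## §1. Generic: Castella's Selmer structure under a morphism of coefficients; retractions on `H¹` -/

section Generic

variable {K : Type u} [Field K]
  {M₁ : Type u} [AddCommGroup M₁] [TopologicalSpace M₁] [DiscreteTopology M₁]
  {M₂ : Type u} [AddCommGroup M₂] [TopologicalSpace M₂] [DiscreteTopology M₂]
  {ρ₁ : DiscreteGaloisModule K M₁} {ρ₂ : DiscreteGaloisModule K M₂}

/-- **Over every `K`-field `E`: `H¹(g|_E) (H¹(f|_E) x) = x` when `g ∘ f = id`** — so `H¹(f|_E)` is injective. [cite: SerreGaloisCohomology1997, I §2.4] -/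
theorem galoisCohomology_map_restrictField_injective (E : Type u) [Field E] [Algebra K E]
    (f : ρ₁.toContRepresentation →ⁱL ρ₂.toContRepresentation) (g : ρ₂.toContRepresentation →ⁱL ρ₁.toContRepresentation)
    (hgf : ∀ a : M₁, g (f a) = a) :
    Function.Injective (galoisCohomology.map (f.restrictField E) 1) :=
  map_injective_of_comp_eq (ρ₁ := GaloisRep.restrictField E ρ₁) (ρ₂ := GaloisRep.restrictField E ρ₂)
    (f.restrictField E) (g.restrictField E) hgf

/-- **A uniform killing exponent for a finite subgroup of `H¹(K, M)`, `M` `p`-primary** (every class is killed by a power of `p`,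
`Levels.exists_pow_nsmul_eq_zero_of_primary`; take the maximum over the finite subgroup). [cite: GreenbergLNM1716, §2] -/
theorem exists_pow_nsmul_eq_zero_of_finite_of_primary {p : ℕ} (hB : ∀ b : M₁, ∃ k : ℕ, p ^ k • b = 0)
    (G : AddSubgroup (galoisCohomology ρ₁ 1)) [Finite G] : ∃ e : ℕ, 1 ≤ e ∧ ∀ x ∈ G, p ^ e • x = 0 := by
  haveI : Fintype G := Fintype.ofFinite G
  choose k hk using fun g : G ↦ exists_pow_nsmul_eq_zero_of_primary ρ₁ hB (g : galoisCohomology ρ₁ 1)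
  refine ⟨(Finset.univ.sup k) + 1, Nat.le_add_left 1 _, fun x hx ↦ ?_⟩
  have hle : k ⟨x, hx⟩ ≤ Finset.univ.sup k + 1 := (Finset.le_sup (Finset.mem_univ _)).trans (Nat.le_succ _)
  obtain ⟨d, hd⟩ := Nat.exists_eq_add_of_le hle
  rw [hd, pow_add, mul_comm, mul_smul, hk ⟨x, hx⟩, smul_zero]

variable [NumberField K]

/-- **A retraction of coefficients makes `H¹(K_v, M₁)` finite as soon as `H¹(K_v, M₂)` is** (`H¹(f|_{K_v})` is injective).
[cite: MilneADT2006, Ch. I Thm. 2.8] -/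
theorem finite_galoisCohomology_toLocal_of_retraction (f : ρ₁.toContRepresentation →ⁱL ρ₂.toContRepresentation)
    (g : ρ₂.toContRepresentation →ⁱL ρ₁.toContRepresentation) (hgf : ∀ a : M₁, g (f a) = a) (v : Place K)
    (hfin : Finite (galoisCohomology (ρ₂.toLocal v) 1)) : Finite (galoisCohomology (ρ₁.toLocal v) 1) := by
  exact Finite.of_injective (β := galoisCohomology (ρ₂.toLocal v) 1) _
    (galoisCohomology_map_restrictField_injective (Place.Completion v) f g hgf)

/-- **An intertwining map of coefficients carries Castella's Selmer group `H¹_{𝓛^{ac,R}_𝔮}(K, M₁)` into `H¹_{𝓛^{ac,R}_𝔮}(K, M₂)`**: every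
local condition of `acStructure` is `0` or everything, and `loc_v ∘ H¹(f) = H¹(f|_{K_v}) ∘ loc_v`. [cite: Castella2018, Def. 2.2 (arXiv:1704.06608 p. 5)] -/
theorem map_mem_selmerGroup_acStructure (f : ρ₁.toContRepresentation →ⁱL ρ₂.toContRepresentation) (p : ℕ)
    (𝔮 : HeightOneSpectrum (𝓞 K)) (R : Set (HeightOneSpectrum (𝓞 K))) {x : galoisCohomology ρ₁ 1}
    (hx : x ∈ (acStructure ρ₁ p 𝔮 R).selmerGroup) : galoisCohomology.map f 1 x ∈ (acStructure ρ₂ p 𝔮 R).selmerGroup := by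
  rw [SelmerStructure.mem_selmerGroup_iff] at hx ⊢
  intro v
  have hv := hx v
  rcases v with w | v
  · rw [acStructure_inl, AddSubgroup.mem_bot] at hv ⊢
    rw [localization_map_one, hv]
    exact (galoisCohomology.map _ 1).map_zero
  · rw [acStructure_inr] at hv ⊢
    by_cases h : v = 𝔮 ∨ (((p : ℕ) : 𝓞 K) ∉ v.asIdeal ∧ v ∉ R)
    · rw [if_pos h, AddSubgroup.mem_bot] at hv ⊢
      rw [localization_map_one, hv]
      exact (galoisCohomology.map _ 1).map_zero
    · rw [if_neg h]
      exact AddSubgroup.mem_top _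

end Generic

/-! ## §2. The conjugate summand `W*′ = E[𝔮_{r′}^∞]` as a discrete Galois module; its local and relaxed finiteness -/

section Summand

variable {K : Type u} [Field K] [NumberField K] (V : WeierstrassCurve K) [V.IsElliptic] (p : ℕ) [Fact p.Prime]
  (π : V.endRing) (r' : ℤ_[p])

omit [NumberField K] [V.IsElliptic] in
/-- Open stabilisers of the summand, in the `{σ | σ • m = m}` form of `LocBridge.ofSMul`. [cite: SerreGaloisCohomology1997, II.§1] -/
theorem isOpen_setOf_smul_eq_summand (m : ↥(V.endEigenPrimaryTorsion p π r')) :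
    IsOpen {σ : absoluteGaloisGroup K | σ • m = m} :=
  isOpen_stabilizer_endEigenPrimaryTorsion V p π r' m

omit [NumberField K] [V.IsElliptic] in
/-- **The inclusion `ι′ : W*′ ↪ E[p^∞]` as an intertwining map** of the discrete Galois modules `LocBridge.ofSMul W*′` and
`LocBridge.primaryGaloisModule V p`. [cite: SerreGaloisCohomology1997, I §2.2] -/
theorem exists_summandIncl :
    ∃ ιI : (ofSMul ↥(V.endEigenPrimaryTorsion p π r') (isOpen_setOf_smul_eq_summand V p π r')).toContRepresentation →ⁱL
        (primaryGaloisModule V p).toContRepresentation,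
      ∀ x : ↥(V.endEigenPrimaryTorsion p π r'), ιI x = (x : V.geomPrimaryTorsion p) :=
  ⟨{ toContinuousLinearMap := ⟨(V.endEigenPrimaryTorsion p π r').subtype.toIntLinearMap, continuous_of_discreteTopology⟩
     isIntertwining' := fun σ ↦ by ext x; rfl }, fun _ ↦ rfl⟩

omit [NumberField K] [V.IsElliptic] in
/-- **An additive equivariant projector `e′ : E[p^∞] → W*′` as an intertwining map.** [cite: SerreGaloisCohomology1997, I §2.2] -/
theorem exists_summandProj (e' : V.geomPrimaryTorsion p →+ ↥(V.endEigenPrimaryTorsion p π r'))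
    (he' : ∀ (σ : absoluteGaloisGroup K) (x : V.geomPrimaryTorsion p), e' (σ • x) = σ • e' x) :
    ∃ eI : (primaryGaloisModule V p).toContRepresentation →ⁱL
        (ofSMul ↥(V.endEigenPrimaryTorsion p π r') (isOpen_setOf_smul_eq_summand V p π r')).toContRepresentation,
      ∀ Q : V.geomPrimaryTorsion p, eI Q = e' Q :=
  ⟨{ toContinuousLinearMap := ⟨e'.toIntLinearMap, continuous_of_discreteTopology⟩
     isIntertwining' := fun σ ↦ by
       ext Q
       exact congrArg (fun y : ↥(V.endEigenPrimaryTorsion p π r') ↦ ((y : V.geomPrimaryTorsion p) : V.geomPoints)) (he' σ Q) },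
    fun _ ↦ rfl⟩

/-- **`H¹(K_v, W*′)` is finite at every finite `v ∤ p`**: `ι′_*` is injective (retraction `e′_*`) into the finite `H¹(K_v, E[p^∞])` (X11b
`finite_galoisCohomology_one_primary_toLocalEP`, Milne I 2.8 unconditional). [cite: MilneADT2006, Ch. I Thm. 2.8] [cite: GreenbergLNM1716, §3 Lemma 3.3] -/
theorem finite_galoisCohomology_summand_toLocal (e' : V.geomPrimaryTorsion p →+ ↥(V.endEigenPrimaryTorsion p π r'))
    (he'₁ : ∀ x : ↥(V.endEigenPrimaryTorsion p π r'), e' x = x)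
    (he' : ∀ (σ : absoluteGaloisGroup K) (x : V.geomPrimaryTorsion p), e' (σ • x) = σ • e' x)
    {v : HeightOneSpectrum (𝓞 K)} (hpv : ((p : ℕ) : 𝓞 K) ∉ v.asIdeal) :
    Finite (galoisCohomology ((ofSMul ↥(V.endEigenPrimaryTorsion p π r') (isOpen_setOf_smul_eq_summand V p π r')).toLocal (Sum.inr v)) 1) := by
  obtain ⟨ιI, hι⟩ := exists_summandIncl V p π r'
  obtain ⟨eI, he⟩ := exists_summandProj V p π r' e' he'
  exact finite_galoisCohomology_toLocal_of_retraction ιI eI (fun x ↦ by rw [he, hι, he'₁]) (Sum.inr v)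
    (finite_galoisCohomology_one_primary_toLocalEP (W := V) (p := p) (v := v) hpv)

variable (𝔮 : HeightOneSpectrum (𝓞 K))

omit [V.IsElliptic] in
/-- **`hfinB′` on the Selmer-structure side**: `Finite 𝔖_𝔮(K, W*′)` (Agboola's restricted group = Castella's `selmerOver ⊤ W*′ p 𝔮 ∅`,
definitionally) gives `Finite H¹_{𝓛^{ac,∅}_𝔮}(K, W*′)` (X11b `natCard_selmerOver_top_eq`). [cite: Castella2018, Def. 2.2] [cite: Agboola2007, §3] -/
theorem finite_selmerGroup_acStructure_summand_empty_of_finite_restrictedSelmerBase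
    (hfin : Finite (restrictedSelmerBase ↥(V.endEigenPrimaryTorsion p π r') p 𝔮)) :
    Finite (acStructure (ofSMul ↥(V.endEigenPrimaryTorsion p π r') (isOpen_setOf_smul_eq_summand V p π r')) p 𝔮
      (∅ : Set (HeightOneSpectrum (𝓞 K)))).selmerGroup := by
  refine Nat.finite_of_card_ne_zero ?_
  have h := natCard_selmerOver_top_eq (M := ↥(V.endEigenPrimaryTorsion p π r')) (isOpen_setOf_smul_eq_summand V p π r') p 𝔮
    (∅ : Set (HeightOneSpectrum (𝓞 K)))
  rw [← h]
  haveI := hfin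
  exact (Nat.card_pos (α := restrictedSelmerBase ↥(V.endEigenPrimaryTorsion p π r') p 𝔮)).ne'

/-- **The RELAXED conjugate group of the summand is finite**: `Finite H¹_{𝓛^{ac,R}_𝔮}(K, W*′)` for every finite `R` away from `p`, from
`hfinB′` and the local finiteness at `R`. [cite: GreenbergLNM1716, §3 Lemma 3.3 (p. 87)] [cite: Castella2018, Def. 2.2] -/
theorem finite_selmerGroup_acStructure_summand (e' : V.geomPrimaryTorsion p →+ ↥(V.endEigenPrimaryTorsion p π r'))
    (he'₁ : ∀ x : ↥(V.endEigenPrimaryTorsion p π r'), e' x = x)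
    (he' : ∀ (σ : absoluteGaloisGroup K) (x : V.geomPrimaryTorsion p), e' (σ • x) = σ • e' x)
    {R : Set (HeightOneSpectrum (𝓞 K))} (hR : R.Finite)
    (hfin : Finite (restrictedSelmerBase ↥(V.endEigenPrimaryTorsion p π r') p 𝔮)) :
    Finite (acStructure (ofSMul ↥(V.endEigenPrimaryTorsion p π r') (isOpen_setOf_smul_eq_summand V p π r')) p 𝔮 R).selmerGroup :=
  finite_selmerGroup_acStructure_of_finite_empty _ p 𝔮 R hR
    (finite_selmerGroup_acStructure_summand_empty_of_finite_restrictedSelmerBase V p π r' 𝔮 hfin)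
    fun _ _ hpv ↦ finite_galoisCohomology_summand_toLocal V p π r' e' he'₁ he' hpv

end Summand

/-! ## §3. The exponent -/

section Exponent

variable {K : Type u} [Field K] [NumberField K] (V : WeierstrassCurve K) [V.IsElliptic] (p : ℕ) [Fact p.Prime]
  (π : V.endRing) (r' : ℤ_[p]) (𝔮 : HeightOneSpectrum (𝓞 K))

/-- **THE KILLING EXPONENT, projector form.** For every additive equivariant projector `e′ : E[p^∞] → W*′` (`e′ ∘ ι′ = id`), every finite
`R` away from `p`, and `hfinB′ : Finite 𝔖_𝔮(K, W*′)`: there is `e ≥ 1` with `p^e · H¹(e′) x = 0` for EVERY `x ∈ H¹_{𝓛^{ac,R}_𝔮}(K, E[p^∞])`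
(and every intertwining form `eI` of `e′`). [cite: JetchevSkinnerWan2017, Prop. 3.3.2 (arXiv:1512.06894 p. 11)] [cite: GreenbergLNM1716, §3 Lemma 3.3] -/
theorem exists_pow_nsmul_map_summandProj_eq_zero (e' : V.geomPrimaryTorsion p →+ ↥(V.endEigenPrimaryTorsion p π r'))
    (he'₁ : ∀ x : ↥(V.endEigenPrimaryTorsion p π r'), e' x = x)
    (he' : ∀ (σ : absoluteGaloisGroup K) (x : V.geomPrimaryTorsion p), e' (σ • x) = σ • e' x)
    {R : Set (HeightOneSpectrum (𝓞 K))} (hR : R.Finite)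
    (hfin : Finite (restrictedSelmerBase ↥(V.endEigenPrimaryTorsion p π r') p 𝔮)) :
    ∃ e : ℕ, 1 ≤ e ∧
      ∀ (eI : (primaryGaloisModule V p).toContRepresentation →ⁱL
          (ofSMul ↥(V.endEigenPrimaryTorsion p π r') (isOpen_setOf_smul_eq_summand V p π r')).toContRepresentation),
        (∀ Q : V.geomPrimaryTorsion p, eI Q = e' Q) →
      ∀ x ∈ (acStructure (primaryGaloisModule V p) p 𝔮 R).selmerGroup, p ^ e • galoisCohomology.map eI 1 x = 0 := by
  haveI := finite_selmerGroup_acStructure_summand V p π r' 𝔮 e' he'₁ he' hR hfin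
  obtain ⟨e, he1, he⟩ := exists_pow_nsmul_eq_zero_of_finite_of_primary
    (ρ₁ := ofSMul ↥(V.endEigenPrimaryTorsion p π r') (isOpen_setOf_smul_eq_summand V p π r'))
    (exists_pow_smul_endEigenPrimaryTorsion_eq_zero V p π r')
    (acStructure (ofSMul ↥(V.endEigenPrimaryTorsion p π r') (isOpen_setOf_smul_eq_summand V p π r')) p 𝔮 R).selmerGroup
  exact ⟨e, he1, fun eI _ x hx ↦ he _ (map_mem_selmerGroup_acStructure eI p 𝔮 R hx)⟩

/-- **THE KILLING EXPONENT, endomorphism form (the shape of X11b's hypothesis `he`, for the `W*′`-COMPONENT).** Same hypotheses; conclusion: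
`∃ e ≥ 1`, for EVERY intertwining endomorphism `ψ′` of `E[p^∞]` with `ψ′ Q = ι′ (e′ Q)` and every `x ∈ H¹_{𝓛^{ac,R}_𝔮}(K, E[p^∞])`:
`p^e · H¹(ψ′) x = 0` (`H¹(ψ′) = H¹(ι′) ∘ H¹(e′)`). [cite: JetchevSkinnerWan2017, Prop. 3.3.2 (arXiv:1512.06894 p. 11)]
[cite: GreenbergLNM1716, §3 Lemma 3.3] -/
theorem exists_pow_nsmul_map_eq_zero_of_apply_eq_proj (e' : V.geomPrimaryTorsion p →+ ↥(V.endEigenPrimaryTorsion p π r'))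
    (he'₁ : ∀ x : ↥(V.endEigenPrimaryTorsion p π r'), e' x = x)
    (he' : ∀ (σ : absoluteGaloisGroup K) (x : V.geomPrimaryTorsion p), e' (σ • x) = σ • e' x)
    {R : Set (HeightOneSpectrum (𝓞 K))} (hR : R.Finite)
    (hfin : Finite (restrictedSelmerBase ↥(V.endEigenPrimaryTorsion p π r') p 𝔮)) :
    ∃ e : ℕ, 1 ≤ e ∧
      ∀ (ψ : (primaryGaloisModule V p).toContRepresentation →ⁱL (primaryGaloisModule V p).toContRepresentation),
        (∀ Q : V.geomPrimaryTorsion p, ψ Q = (e' Q : V.geomPrimaryTorsion p)) →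
      ∀ x ∈ (acStructure (primaryGaloisModule V p) p 𝔮 R).selmerGroup, p ^ e • galoisCohomology.map ψ 1 x = 0 := by
  obtain ⟨e, he1, he⟩ := exists_pow_nsmul_map_summandProj_eq_zero V p π r' 𝔮 e' he'₁ he' hR hfin
  obtain ⟨ιI, hι⟩ := exists_summandIncl V p π r'
  obtain ⟨eI, heI⟩ := exists_summandProj V p π r' e' he'
  refine ⟨e, he1, fun ψ hψ x hx ↦ ?_⟩
  -- `H¹(ψ′) = H¹(ι′) ∘ H¹(e′)` (cocycle level), so `p^e · H¹(ψ′) x = H¹(ι′) (p^e · H¹(e′) x) = 0`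
  have hfac : galoisCohomology.map ψ 1 x = galoisCohomology.map ιI 1 (galoisCohomology.map eI 1 x) := by
    obtain ⟨φ, rfl⟩ := oneCocycleClass_surjective _ x
    rw [galoisCohomology.map_one_oneCocycleClass, galoisCohomology.map_one_oneCocycleClass, galoisCohomology.map_one_oneCocycleClass]
    exact congrArg (oneCocycleClass _) (Subtype.ext (ContinuousMap.ext fun σ ↦ by
      change ψ (φ.1 σ) = ιI (eI (φ.1 σ))
      rw [hψ, heI, hι]))
  rw [hfac, ← map_nsmul, he eI heI x hx, map_zero]

end Exponent

end Summit.BirchSwinnertonDyer.BirchSwinnertonDyer.Theorems.PrintCf2.RelaxedExponent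

end
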